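import Summits.CriticalPhenomena.PercolationContinuityZ3.Theorems.PercNearOneGluingNoHeavyLowerTailPendantWitness
import Summits.CriticalPhenomena.PercolationContinuityZ3.Theorems.PercNearOneGluingNoHeavyLowerTailQ9OfLayers
import HarnessLib

/-!
# `NoHeavyLowerTail` (stmt-CriticalPhenomena-4575) — Kozma–Nitzan Question 9 at a DEPTH-TWO observer for an anchor pendant at `b`,
# with any number of one-layer children carrying any number of ports, over an arbitrary core

Support file (lemma factory `prim-lf-2`, deletion–contraction line, gen 10; `--supports stmt-CriticalPhenomena-4575`).
No definitions, no named facts, no sorries.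

Kozma–Nitzan's Question 9 (arXiv:2401.12397, p. 14) asks whether `P(a ↔ b, o ↔ A) ≤ P(o ↔ b)` for the relay `a` minimising
`P_{G∖o}(· ↔ b)`.  `BlockQ9.depthTwo_q9_of_hubBlocks` (seat `prim-hp-1`) reduces it, for an observer `o`, to inequality (41) for
every glued hub block `S` (a set of neighbours of `o`) in `kill_o w`; `PendantWitness.block41_of_pendantWitness` (this seat) proves (41)
for a one-layer block and a witness pendant at `b` under a single split comparison.  Together:

* `PendantWitness.q9_depthTwo_of_pendantAnchor` — let `o ∉ A` be an observer all of whose neighbours are non-relay ONE-LAYER vertices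
  (every positive pair at a neighbour `x` of `o` goes to `o` or into `A`; in particular distinct neighbours of `o` are not joined), and
  let `a ≠ b` be PENDANT AT `b` (every pair at `a` other than `s(a,b)` has weight `0`) and dominated in `G ∖ o` by every port of every
  neighbour of `o` (`μ_{kill_o w}(a ↔ b) ≤ μ_{kill_o w}(p ↔ b)`; e.g. `a` the `G ∖ o`-minimiser of Question 9).  Then
  `μ_w(a ↔ b, o ↔ A) ≤ μ_w(o ↔ b)`.
  No restriction on the number of neighbours of `o`, on their port sets, or on the core (the graph off `o` and its neighbours).
  [Previously in the tree: hub-star cores / children with ≤ 2 ports (prim-hp-2, prim-lf-3, lead), at goodness strength.]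
-/

noncomputable section

namespace Summit.CriticalPhenomena.PercolationContinuityZ3.Theorems

open MeasureTheory Set Literature.Probability.LatticeModels Literature.Probability.Percolation
open scoped Classical BigOperators

variable {n : ℕ}

namespace PendantWitness

/-- **Question 9 at a depth-two observer for a pendant anchor** (see the module docstring).
[cite: KozmaNitzan2024, Question 9 (p. 14), Thm. 4 and Lemma 5 (pp. 12–14)] -/
theorem q9_depthTwo_of_pendantAnchor (w : Sym2 (Fin n) → unitInterval) (A : Finset (Fin n)) (o a b : Fin n)
    (hoA : o ∉ A) (hao : a ≠ o) (hbo : b ≠ o) (hab : a ≠ b)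
    (hchild : ∀ x : Fin n, x ≠ o → w s(o, x) ≠ 0 → x ∉ A)
    (h1L : ∀ x : Fin n, x ≠ o → w s(o, x) ≠ 0 → ∀ y : Fin n, y ≠ o → y ≠ x → y ∉ A → w s(x, y) = 0)
    (hpend : ∀ z : Fin n, z ≠ b → w s(a, z) = 0)
    (hdomH : ∀ x p : Fin n, x ≠ o → w s(o, x) ≠ 0 → p ∈ A → w s(x, p) ≠ 0 →
      (prodBernoulli (fun e : Sym2 (Fin n) => if o ∈ e then 0 else w e)).real (openConn a b) ≤
        (prodBernoulli (fun e : Sym2 (Fin n) => if o ∈ e then 0 else w e)).real (openConn p b)) :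
    (prodBernoulli w).real (openConn a b ∩ ⋃ x ∈ A, openConn o x) ≤ (prodBernoulli w).real (openConn o b) := by
  classical
  refine BlockQ9.depthTwo_q9_of_hubBlocks w A o a b hoA hao hbo fun S hS hSne hbS => ?_
  -- the world with `o` killed
  let wo : Sym2 (Fin n) → unitInterval := fun e => if o ∈ e then 0 else w e
  have hwo_of : ∀ u v : Fin n, u ≠ o → v ≠ o → wo s(u, v) = w s(u, v) := by
    intro u v hu hv
    show (if o ∈ s(u, v) then (0 : unitInterval) else w s(u, v)) = w s(u, v)
    rw [if_neg]
    intro h; rcases Sym2.mem_iff.1 h with h | h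
    · exact hu h.symm
    · exact hv h.symm
  have hSo : ∀ x ∈ S, x ≠ o := fun x hx => (hS x hx).1
  have hSA : Disjoint S A :=
    Finset.disjoint_left.2 fun x hxS hxA => hchild x (hS x hxS).1 (hS x hxS).2 hxA
  have haS : a ∉ S := by
    intro haS
    apply (hS a haS).2
    rw [Sym2.eq_swap]; exact hpend o hbo.symm
  -- ports of the block `S`
  set P : Finset (Fin n) := A.filter (fun v => ∃ x ∈ S, w s(x, v) ≠ 0) with hP
  -- the comparison vertex: a port of `S` minimising the killed reliability, or `a` itself if `S` has no port
  have main : ∀ i : Fin n, i ∉ S →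
      (∀ v ∈ A, (∃ x ∈ S, wo s(x, v) ≠ 0) →
        (prodBernoulli (fun e : Sym2 (Fin n) => if (∃ x ∈ e, x ∈ S) then 0 else wo e)).real (openConn i b) ≤
          (prodBernoulli (fun e : Sym2 (Fin n) => if (∃ x ∈ e, x ∈ S) then 0 else wo e)).real (openConn v b)) →
      (prodBernoulli wo).real (openConn a b) ≤ (prodBernoulli wo).real (openConn i b) →
      (prodBernoulli (fun e : Sym2 (Fin n) => if (∀ x ∈ e, x ∈ S) ∧ ¬ e.IsDiag then 1 else wo e)).real
          (openConn a b ∩ ⋃ s ∈ S, ⋃ x ∈ A, openConn s x) ≤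
        (prodBernoulli (fun e : Sym2 (Fin n) => if (∀ x ∈ e, x ∈ S) ∧ ¬ e.IsDiag then 1 else wo e)).real
          (⋃ s ∈ S, openConn s b) := by
    intro i hiS hdom hcmp
    refine block41_of_pendantWitness wo S A a i b hSA haS hiS hbS hab ?_ ?_ hdom hcmp
    · intro x hx y hyS hyA
      by_cases hyo : y = o
      · subst hyo
        show (if y ∈ s(x, y) then (0 : unitInterval) else w s(x, y)) = 0
        rw [if_pos (Sym2.mem_mk_right x y)]
      · have hyx : y ≠ x := fun h => hyS (h ▸ hx)
        rw [hwo_of x y (hSo x hx) hyo]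
        exact h1L x (hSo x hx) (hS x hx).2 y hyo hyx hyA
    · intro z _ hzb
      show (if o ∈ s(a, z) then (0 : unitInterval) else w s(a, z)) = 0
      split_ifs
      · rfl
      · exact hpend z hzb
  by_cases hPne : P.Nonempty
  · obtain ⟨i, hiP, himin⟩ := P.exists_min_image
      (fun v => (prodBernoulli (fun e : Sym2 (Fin n) => if (∃ x ∈ e, x ∈ S) then 0 else wo e)).real (openConn v b)) hPne
    have hiA : i ∈ A := (Finset.mem_filter.1 hiP).1
    have hiS : i ∉ S := fun h => Finset.disjoint_left.1 hSA h hiA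
    refine main i hiS (fun v hv hex => ?_) ?_
    · obtain ⟨x, hx, hne⟩ := hex
      have hvo : v ≠ o := fun h => hoA (h ▸ hv)
      rw [hwo_of x v (hSo x hx) hvo] at hne
      exact himin v (Finset.mem_filter.2 ⟨hv, x, hx, hne⟩)
    · obtain ⟨x, hx, hne⟩ := (Finset.mem_filter.1 hiP).2
      exact hdomH x i (hSo x hx) (hS x hx).2 hiA hne
  · refine main a haS (fun v hv hex => ?_) le_rfl
    obtain ⟨x, hx, hne⟩ := hex
    have hvo : v ≠ o := fun h => hoA (h ▸ hv)
    rw [hwo_of x v (hSo x hx) hvo] at hne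
    exact absurd ⟨v, Finset.mem_filter.2 ⟨hv, x, hx, hne⟩⟩ hPne


/-- **Question 9 at a depth-two observer for a pendant anchor — relay neighbours of `o` allowed.**  As
`q9_depthTwo_of_pendantAnchor`, but `o` may also be joined directly to relays (hairs at the observer): every NON-relay neighbour of
`o` is one-layer, the anchor `a` is pendant at `b` in `G ∖ o` (it may itself be a neighbour of `o`) and is dominated in `G ∖ o` by
every relay neighbour of `o` and by every port of every non-relay neighbour.  Layers containing a relay are settled by Kozma–Nitzan's
Lemma 5 (`stub_gluingLemma5`), the others by `block41_of_pendantWitness`. [cite: KozmaNitzan2024, Question 9 (p. 14), Lemma 5 (p. 13)] -/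
theorem q9_depthTwo_of_pendantAnchor_relayNbrs (w : Sym2 (Fin n) → unitInterval) (A : Finset (Fin n)) (o a b : Fin n)
    (hoA : o ∉ A) (hao : a ≠ o) (hbo : b ≠ o) (hab : a ≠ b)
    (h1L : ∀ x : Fin n, x ≠ o → x ∉ A → w s(o, x) ≠ 0 → ∀ y : Fin n, y ≠ o → y ≠ x → y ∉ A → w s(x, y) = 0)
    (hpend : ∀ z : Fin n, z ≠ b → z ≠ o → w s(a, z) = 0)
    (hdomP : ∀ x p : Fin n, x ≠ o → x ∉ A → w s(o, x) ≠ 0 → p ∈ A → w s(x, p) ≠ 0 →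
      (prodBernoulli (fun e : Sym2 (Fin n) => if o ∈ e then 0 else w e)).real (openConn a b) ≤
        (prodBernoulli (fun e : Sym2 (Fin n) => if o ∈ e then 0 else w e)).real (openConn p b))
    (hdomR : ∀ p ∈ A, w s(o, p) ≠ 0 →
      (prodBernoulli (fun e : Sym2 (Fin n) => if o ∈ e then 0 else w e)).real (openConn a b) ≤
        (prodBernoulli (fun e : Sym2 (Fin n) => if o ∈ e then 0 else w e)).real (openConn p b)) :
    (prodBernoulli w).real (openConn a b ∩ ⋃ x ∈ A, openConn o x) ≤ (prodBernoulli w).real (openConn o b) := by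
  classical
  refine BlockQ9.depthTwo_q9_of_hubBlocks w A o a b hoA hao hbo fun S hS hSne hbS => ?_
  let wo : Sym2 (Fin n) → unitInterval := fun e => if o ∈ e then 0 else w e
  have hwo_of : ∀ u v : Fin n, u ≠ o → v ≠ o → wo s(u, v) = w s(u, v) := by
    intro u v hu hv
    show (if o ∈ s(u, v) then (0 : unitInterval) else w s(u, v)) = w s(u, v)
    rw [if_neg]
    intro h; rcases Sym2.mem_iff.1 h with h | h
    · exact hu h.symm
    · exact hv h.symm
  have hSo : ∀ x ∈ S, x ≠ o := fun x hx => (hS x hx).1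
  set g : Sym2 (Fin n) → unitInterval := fun e => if (∀ x ∈ e, x ∈ S) ∧ ¬ e.IsDiag then 1 else wo e with hg
  haveI : IsProbabilityMeasure (prodBernoulli g) := inferInstance
  -- the goal, in the form produced by `depthTwo_q9_of_hubBlocks`, is about `prodBernoulli g`
  show (prodBernoulli g).real (openConn a b ∩ ⋃ s ∈ S, ⋃ x ∈ A, openConn s x) ≤
    (prodBernoulli g).real (⋃ s ∈ S, openConn s b)
  -- Case 0: the anchor itself lies in the layer
  by_cases haS : a ∈ S
  · refine measureReal_mono (fun ω hω => ?_) (measure_ne_top _ _)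
    simp only [mem_iUnion, exists_prop]
    exact ⟨a, haS, hω.1⟩
  -- Case 1: the layer contains a relay neighbour `p` of `o`: Lemma 5
  by_cases hrel : ∃ p ∈ S, p ∈ A
  · obtain ⟨p, hpS, hpA⟩ := hrel
    have hcmp : (prodBernoulli wo).real (openConn a b) ≤ (prodBernoulli wo).real (openConn p b) :=
      hdomR p hpA (hS p hpS).2
    have h5 := stub_gluingLemma5 n wo S a p b hpS hbS hcmp
    exact le_trans (measureReal_mono inter_subset_left (measure_ne_top _ _)) h5
  -- Case 2: a layer of one-layer children: the pendant-witness lemma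
  push Not at hrel
  have hSA : Disjoint S A := Finset.disjoint_left.2 fun x hxS hxA => hrel x hxS hxA
  set P : Finset (Fin n) := A.filter (fun v => ∃ x ∈ S, w s(x, v) ≠ 0) with hP
  have main : ∀ i : Fin n, i ∉ S →
      (∀ v ∈ A, (∃ x ∈ S, wo s(x, v) ≠ 0) →
        (prodBernoulli (fun e : Sym2 (Fin n) => if (∃ x ∈ e, x ∈ S) then 0 else wo e)).real (openConn i b) ≤
          (prodBernoulli (fun e : Sym2 (Fin n) => if (∃ x ∈ e, x ∈ S) then 0 else wo e)).real (openConn v b)) →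
      (prodBernoulli wo).real (openConn a b) ≤ (prodBernoulli wo).real (openConn i b) →
      (prodBernoulli g).real (openConn a b ∩ ⋃ s ∈ S, ⋃ x ∈ A, openConn s x) ≤
        (prodBernoulli g).real (⋃ s ∈ S, openConn s b) := by
    intro i hiS hdom hcmp
    refine block41_of_pendantWitness wo S A a i b hSA haS hiS hbS hab ?_ ?_ hdom hcmp
    · intro x hx y hyS hyA
      by_cases hyo : y = o
      · subst hyo
        show (if y ∈ s(x, y) then (0 : unitInterval) else w s(x, y)) = 0
        rw [if_pos (Sym2.mem_mk_right x y)]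
      · have hyx : y ≠ x := fun h => hyS (h ▸ hx)
        rw [hwo_of x y (hSo x hx) hyo]
        exact h1L x (hSo x hx) (hrel x hx) (hS x hx).2 y hyo hyx hyA
    · intro z _ hzb
      show (if o ∈ s(a, z) then (0 : unitInterval) else w s(a, z)) = 0
      split_ifs with h
      · rfl
      · have hzo : z ≠ o := fun hz => h (hz ▸ Sym2.mem_mk_right a z)
        exact hpend z hzb hzo
  by_cases hPne : P.Nonempty
  · obtain ⟨i, hiP, himin⟩ := P.exists_min_image
      (fun v => (prodBernoulli (fun e : Sym2 (Fin n) => if (∃ x ∈ e, x ∈ S) then 0 else wo e)).real (openConn v b)) hPne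
    have hiA : i ∈ A := (Finset.mem_filter.1 hiP).1
    have hiS : i ∉ S := fun h => Finset.disjoint_left.1 hSA h hiA
    refine main i hiS (fun v hv hex => ?_) ?_
    · obtain ⟨x, hx, hne⟩ := hex
      have hvo : v ≠ o := fun h => hoA (h ▸ hv)
      rw [hwo_of x v (hSo x hx) hvo] at hne
      exact himin v (Finset.mem_filter.2 ⟨hv, x, hx, hne⟩)
    · obtain ⟨x, hx, hne⟩ := (Finset.mem_filter.1 hiP).2
      exact hdomP x i (hSo x hx) (hrel x hx) (hS x hx).2 hiA hne
  · refine main a haS (fun v hv hex => ?_) le_rfl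
    obtain ⟨x, hx, hne⟩ := hex
    have hvo : v ≠ o := fun h => hoA (h ▸ hv)
    rw [hwo_of x v (hSo x hx) hvo] at hne
    exact absurd ⟨v, Finset.mem_filter.2 ⟨hv, x, hx, hne⟩⟩ hPne

end PendantWitness

end Summit.CriticalPhenomena.PercolationContinuityZ3.Theorems

end
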